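import Literature.IUT.HodgeTheaters.GenuineFKitOfBadLocalNV
import Literature.IUT.HodgeTheaters.GenuineFKitOfBadLocalTemperedSideNV
import Literature.IUT.HodgeTheaters.InitialThetaDataTorsionCuspModelPointEvalSections
import HarnessLib

/-!
# The (m2) group datum of the merge record at EVERY CLOSED bad pair: `Π_v̲ := (B x).H ≤ Π_{C_F}` closed ⇒ the GENUINE
# augmentation `Π_v̲ ↠ Gal(K̄_v̲/K_v̲)` exists, is canonical (the unique `rhoAt`-compatible homomorphism), continuous,
# surjective and OPEN — so `BadLocalGroupDatum (GalAt x) ↥(B x).H` and `Nonempty (MergeInputs D B)` for every such `B`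

S. Mochizuki, *Inter-universal Teichmüller theory I*, kurims manuscript (May 2020), Def. 3.1 (e)(f) pp. 62–63 («the various
profinite groups `Π_(−)` admit natural outer surjections onto the decomposition group `G_v ⊆ G_K`»; «`Π_v̲ := Π^tp_{X̲̳_v̲}`»),
Example 3.2 (i) p. 70 («the natural surjection `Π_v ↠ G_v`»), (ii) p. 70, (v) p. 72 («the base field of `Ÿ_v` is equal to `K_v`»)
([IUTchI] Def 3.1 (e) p.62) [claim: Mochizuki2012, status: disputed] (D-0012 claim key, series status DISPUTED — pure topological-group
theory over abc-iut-L5-t2's REAL `InitialThetaData` and the landed `BadPairAt` interface; nothing of the series is asserted; no side is taken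
on [IUTchIII] Cor. 3.12).

PURPOSE (abc-iut cell, L5 hub; row R59/R59b «M2-GENUINE-CENSUS», GAP-LEDGER row G-L5-EX32M2-1).  The (m2) field of the merge record
`InitialThetaData.MergeInputs D B` (★ p496697) asks, at every bad index `x`, for a `BadLocalGroupDatum (D.GalAt x _) ↥(B x hx).H`: a
continuous OPEN augmentation `(B x hx).H →* Gal(K̄_v̲/K_v̲)` and an open `Π_Ÿ` surjecting onto the Galois group.  It was inhabited in tree only
at the `X̲→`-profinite stand-in `B := badPairAtArrow hA` (abc-iut-L5-t2 ★ p499559 `m2StandIn`).  THIS FILE proves that (m2) is inhabited at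
**every** bad-pair family `B : ∀ v, v ∈ D.indexCopyBad → D.BadPairAt v` whose local groups `(B x hx).H ≤ Π_{C_F}` are CLOSED — the one
displayed input — so that the GAP row G-L5-EX32M2-1 («INHABIT a genuine `B` … TOGETHER WITH `m2` with open continuous surjective aug»)
reduces to its first half («INHABIT a genuine `B`»; the closure of the image of the wanted junction `j` is closed by construction):
* `rhoAtEquiv x hx : D.GalAt x hx ≃ₜ* ↥(D.decompAt x)` — the identification `Gal(K̄_v̲/K_v̲) ⥲ G_v̲ ⊆ G_F` (Def. 3.1 (e)) as a bicontinuous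
  group isomorphism: `rhoAt` (abc-iut-L5-t2) is injective (Krasner density, `localToGF_injective_adicCompletion`), continuous
  (`continuous_localToGF`), with image `decompAt x` (`decompAt_eq_range_rhoAt`), from a compact group to a Hausdorff one;
* for ANY subgroup `H ≤ Π_{C_F}` lying over `G_v̲` (`H ≤ augGF⁻¹ G_v̲`): `augOfOver x hx H hle : ↥H →* D.GalAt x hx := rhoAtEquiv⁻¹ ∘ augGF|_H`,
  continuous, `rhoAt`-COMPATIBLE (`rhoAt (aug h) = augGF h`) and the UNIQUE such homomorphism (`augOfOver_unique`); SURJECTIVE as soon as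
  `G_v̲ ≤ augGF(H)`; OPEN as soon as moreover `H` is closed (Mathlib's open-mapping theorem for σ-compact groups onto Baire groups,
  `MonoidHom.isOpenMap_of_sigmaCompact`); `badLocalGroupDatumOfOver` = the resulting [IUTchI] Ex. 3.2 group datum with `Π_Ÿ := Π_v̲` (degenerate);
* at a bad pair: `(B x hx).H` lies over `G_v̲` (the pair's `le_loc`) and `augGF((B x hx).H) = G_K ∩ G_v̲ = G_v̲` (the pair's `map_augGF`;
  `G_v̲ ≤ G_K` is abc-iut-w4-d077's `decompAt_le`, ★ p475487, BY NAME), whence **`m2OfClosed B x hx hH : BadLocalGroupDatum (D.GalAt x _) ↥(B x hx).H`** for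
  `hH : IsClosed ((B x hx).H : Set Π_{C_F})`, `exists_badLocalGroupDatum_of_isClosed` (the statement recorded as wanted by abc-iut-w4-d077 gen 8,
  2026-08-27T05:21:30Z, verbatim), and **`nonempty_mergeInputs_of_isClosed : (∀ x hx, IsClosed …) → GeomTFG → Nonempty (D.MergeInputs B)`**
  (abc-iut-L5-t3 ★ p500005 `nonempty_mergeInputs_of_groupData` BY NAME) with the `iff` form `nonempty_mergeInputs_iff_geomTFG_of_isClosed`
  — the R59 (b)-gate at EVERY closed bad-pair family, not only at the stand-in;
* consistency at the stand-in: the augmentation of abc-iut-L5-t2's `m2StandIn` IS `augOfOver` (`m2StandIn_aug_eq_augOfOver`: both are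
  `rhoAt`-compatible), and at a bad index `m2OfClosed (badPairAtArrow hA) x … = m2StandIn hA … x …` (`m2OfClosed_badPairAtArrow_eq_m2StandIn`;
  the closedness input there is abc-iut-L5-t2's `isClosed_badPairAtArrow_H`, ★ p501395, BY NAME) — the two constructions COINCIDE.
LABEL «[m2 at ANY closed bad pair: aug GENUINE and CANONICAL (= the unique `rhoAt`-compatible homomorphism), `Ÿ` DEGENERATE (`Π_Ÿ := Π_v̲`);
`H` closed = the ONE displayed input; NOT print's tempered `Π^tp_{Ÿ_v̲} ⊊ Π^tp_{X̳_v̲}`]».  BINDER CENSUS: {`D`, `x`, `hx`, `H`/`B`, `hle`/`hge`/`hH`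
displayed} (+ FACT F-0240 `hTFG` by name for the `MergeInputs` corollaries); LAW 0; no new `Prop` fact; no instance, no notation, no `sorry`.
An inhabitant witnesses the joint satisfiability of OUR binders — nothing more; typed ≠ inhabited ≠ proved; nothing here asserts abc proved
or refuted.
-/

noncomputable section

namespace Literature.IUT.HodgeTheaters

open _root_.NumberField _root_.IsDedekindDomain Literature.NumberTheory.NumberFields
  Literature.AnabelianGeometry.SemiGraphs Topology

variable {F K Fbar : Type} [Field F] [NumberField F] [Field K] [NumberField K] [Algebra F K]
  [Field Fbar] [Algebra F Fbar] [Algebra K Fbar] {E : WeierstrassCurve F}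
  [E.IsElliptic] {l : ℕ} {Pb : BadPlacePredicates K} (D : InitialThetaData F K Fbar E l Pb)

namespace BadLocalGroupDatum

universe u in
/-- Two [IUTchI] Ex. 3.2 group data with the same augmentation and the same `Π_Ÿ` are equal (the remaining fields are proofs).
([IUTchI] Ex 3.2 (i) p.70) [claim: Mochizuki2012, status: disputed] -/
theorem ext_of_aug_of_Y {G : Type u} [Group G] [TopologicalSpace G] {P : Type u} [Group P] [TopologicalSpace P]
    {T T' : BadLocalGroupDatum G P} (haug : T.aug = T'.aug) (hY : T.Y = T'.Y) : T = T' := by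
  obtain ⟨aug, _, _, Y, _⟩ := T
  obtain ⟨aug', _, _, Y', _⟩ := T'
  dsimp only at haug hY
  subst haug
  subst hY
  rfl

end BadLocalGroupDatum

namespace InitialThetaData

/-! ### `Gal(K̄_v̲/K_v̲) ⥲ G_v̲ ⊆ G_F` as a bicontinuous isomorphism -/

section Rho

variable (x : D.IndexCopy) (hx : x ∉ D.indexCopyArc)

/-- `Gal(K̄_v̲/K_v̲) → G_F` is INJECTIVE (`K` is dense in the complete field `K_v̲` — Krasner; abc-iut-L5-t2
`localToGF_injective_adicCompletion`). ([IUTchI] Def 3.1 (e) p.62) [claim: Mochizuki2012, status: disputed] -/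
theorem rhoAt_injective : Function.Injective (D.rhoAt x hx) := by
  haveI := D.isScalarTower
  haveI := D.normal_K
  haveI := D.isAlgClosed
  letI : Algebra K (RescaledCompletion K (D.primeAt x hx) (D.specAt x hx) (D.primeAt_mem x hx)) :=
    inferInstanceAs (Algebra K ((D.specAt x hx).adicCompletion K))
  exact localToGF_injective_adicCompletion (D.specAt x hx) _ F

/-- `Gal(K̄_v̲/K_v̲) → G_F` is CONTINUOUS for the Krull topologies (abc-iut-L5-t2 `continuous_localToGF`).
([IUTchI] Def 3.1 (e) p.62) [claim: Mochizuki2012, status: disputed] -/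
theorem continuous_rhoAt : Continuous (D.rhoAt x hx) := by
  haveI := D.isScalarTower
  haveI := D.normal_K
  letI : Algebra K (RescaledCompletion K (D.primeAt x hx) (D.specAt x hx) (D.primeAt_mem x hx)) :=
    inferInstanceAs (Algebra K ((D.specAt x hx).adicCompletion K))
  exact continuous_localToGF F (RescaledCompletion K (D.primeAt x hx) (D.specAt x hx) (D.primeAt_mem x hx))
    (localEmb (K := K) (Fbar := Fbar) (AlgebraicClosure (RescaledCompletion K (D.primeAt x hx) (D.specAt x hx) (D.primeAt_mem x hx))))

/-- `Gal(K̄_v̲/K_v̲) → G_F` lands in the decomposition group `G_v̲ = decompAt x` (abc-iut-L5-t2 `decompAt_eq_range_rhoAt`).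
([IUTchI] Def 3.1 (e) p.62) [claim: Mochizuki2012, status: disputed] -/
theorem rhoAt_mem_decompAt (g : D.GalAt x hx) : D.rhoAt x hx g ∈ D.decompAt x := by
  rw [D.decompAt_eq_range_rhoAt x hx]
  exact ⟨g, rfl⟩

/-- `Gal(K̄_v̲/K_v̲) → G_v̲`, the corestriction of `rhoAt` to its image. ([IUTchI] Def 3.1 (e) p.62) [claim: Mochizuki2012, status: disputed] -/
def rhoAtCod : D.GalAt x hx →* ↥(D.decompAt x) :=
  (D.rhoAt x hx).codRestrict (D.decompAt x) (D.rhoAt_mem_decompAt x hx)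

/-- `rhoAtCod` on elements. ([IUTchI] Def 3.1 (e) p.62) [claim: Mochizuki2012, status: disputed] -/
theorem coe_rhoAtCod (g : D.GalAt x hx) : ((D.rhoAtCod x hx g : ↥(D.decompAt x)) : Fbar ≃ₐ[F] Fbar) = D.rhoAt x hx g := rfl

/-- `Gal(K̄_v̲/K_v̲) → G_v̲` is bijective. ([IUTchI] Def 3.1 (e) p.62) [claim: Mochizuki2012, status: disputed] -/
theorem rhoAtCod_bijective : Function.Bijective (D.rhoAtCod x hx) := by
  refine ⟨fun g g' h => D.rhoAt_injective x hx ?_, fun γ => ?_⟩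
  · rw [← D.coe_rhoAtCod x hx, ← D.coe_rhoAtCod x hx, h]
  · have hγ : (γ : Fbar ≃ₐ[F] Fbar) ∈ (D.rhoAt x hx).range := by
      rw [← D.decompAt_eq_range_rhoAt x hx]; exact γ.2
    obtain ⟨g, hg⟩ := hγ
    exact ⟨g, Subtype.ext hg⟩

/-- **`Gal(K̄_v̲/K_v̲) ≃ₜ* G_v̲`** — the decomposition group of `v̲` IS the local Galois group, as a BICONTINUOUS group isomorphism (a
continuous bijective homomorphism from the compact `Gal(K̄_v̲/K_v̲)` to the Hausdorff `G_v̲ ⊆ G_F`). ([IUTchI] Def 3.1 (e) p.62) [claim: Mochizuki2012, status: disputed] -/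
def rhoAtEquiv : D.GalAt x hx ≃ₜ* ↥(D.decompAt x) :=
  haveI := D.isIntegral_F
  let e : D.GalAt x hx ≃ ↥(D.decompAt x) := Equiv.ofBijective _ (D.rhoAtCod_bijective x hx)
  have he : Continuous e := (D.continuous_rhoAt x hx).subtype_mk _
  { MulEquiv.ofBijective (D.rhoAtCod x hx) (D.rhoAtCod_bijective x hx) with
    continuous_toFun := he
    continuous_invFun := (he.homeoOfEquivCompactToT2 (f := e)).symm.continuous }

/-- `rhoAtEquiv` is `rhoAt` on elements. ([IUTchI] Def 3.1 (e) p.62) [claim: Mochizuki2012, status: disputed] -/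
theorem coe_rhoAtEquiv (g : D.GalAt x hx) : ((D.rhoAtEquiv x hx g : ↥(D.decompAt x)) : Fbar ≃ₐ[F] Fbar) = D.rhoAt x hx g := rfl

/-- `rhoAt ∘ rhoAtEquiv⁻¹` is the inclusion `G_v̲ ⊆ G_F`. ([IUTchI] Def 3.1 (e) p.62) [claim: Mochizuki2012, status: disputed] -/
theorem rhoAt_rhoAtEquiv_symm (γ : ↥(D.decompAt x)) : D.rhoAt x hx ((D.rhoAtEquiv x hx).symm γ) = γ := by
  rw [← D.coe_rhoAtEquiv x hx, ContinuousMulEquiv.apply_symm_apply]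

end Rho

/-! ### The genuine augmentation on ANY subgroup of `Π_{C_F}` lying over `G_v̲` -/

section Over

variable (x : D.IndexCopy) (hx : x ∉ D.indexCopyArc) (H : Subgroup D.PiC) (hle : H ≤ (D.decompAt x).comap D.augGF)

/-- **The genuine augmentation `H ↠ Gal(K̄_v̲/K_v̲)`** of a subgroup `H ≤ Π_{C_F}` lying over `G_v̲`: `augGF|_H : H → G_v̲` followed by
`G_v̲ ≃ Gal(K̄_v̲/K_v̲)` (`rhoAtEquiv⁻¹`). ([IUTchI] Def 3.1 (e) p.62) [claim: Mochizuki2012, status: disputed] -/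
def augOfOver : ↥H →* D.GalAt x hx :=
  (D.rhoAtEquiv x hx).symm.toMonoidHom.comp ((D.augGF.comp H.subtype).codRestrict (D.decompAt x) fun h => hle h.2)

/-- `augOfOver` is `rhoAt`-COMPATIBLE: `rhoAt (aug h) = augGF h`. ([IUTchI] Def 3.1 (e) p.62) [claim: Mochizuki2012, status: disputed] -/
theorem rhoAt_augOfOver (h : ↥H) : D.rhoAt x hx (D.augOfOver x hx H hle h) = D.augGF h :=
  D.rhoAt_rhoAtEquiv_symm x hx _

/-- `augOfOver` is CONTINUOUS. ([IUTchI] Def 3.1 (e) p.62) [claim: Mochizuki2012, status: disputed] -/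
theorem continuous_augOfOver : Continuous (D.augOfOver x hx H hle) :=
  (D.rhoAtEquiv x hx).symm.continuous.comp ((D.continuous_augGF.comp continuous_subtype_val).subtype_mk _)

/-- `augOfOver` is the UNIQUE `rhoAt`-compatible homomorphism `H → Gal(K̄_v̲/K_v̲)` (`rhoAt` is injective): the genuine augmentation is
CANONICAL. ([IUTchI] Def 3.1 (e) p.62) [claim: Mochizuki2012, status: disputed] -/
theorem augOfOver_unique (f : ↥H →* D.GalAt x hx) (hf : ∀ h : ↥H, D.rhoAt x hx (f h) = D.augGF h) :
    f = D.augOfOver x hx H hle :=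
  MonoidHom.ext fun h => D.rhoAt_injective x hx (by rw [hf, D.rhoAt_augOfOver])

/-- `augOfOver` is SURJECTIVE as soon as `G_v̲ ≤ augGF(H)`. ([IUTchI] Ex 3.2 (i) p.70) [claim: Mochizuki2012, status: disputed] -/
theorem augOfOver_surjective (hge : D.decompAt x ≤ H.map D.augGF) : Function.Surjective (D.augOfOver x hx H hle) := by
  intro g
  obtain ⟨h, hh, hgh⟩ := Subgroup.mem_map.mp (hge (D.rhoAt_mem_decompAt x hx g))
  exact ⟨⟨h, hh⟩, D.rhoAt_injective x hx (by rw [D.rhoAt_augOfOver, ← hgh])⟩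

/-- `augOfOver` is OPEN as soon as `G_v̲ ≤ augGF(H)` and `H ≤ Π_{C_F}` is CLOSED: a continuous surjective homomorphism from the compact
group `H` onto the compact Hausdorff group `Gal(K̄_v̲/K_v̲)` is open (Mathlib's open-mapping theorem for σ-compact groups onto Baire
groups, `MonoidHom.isOpenMap_of_sigmaCompact`). ([IUTchI] Ex 3.2 (i) p.70) [claim: Mochizuki2012, status: disputed] -/
theorem isOpenMap_augOfOver (hge : D.decompAt x ≤ H.map D.augGF) (hH : IsClosed (H : Set D.PiC)) :
    IsOpenMap (D.augOfOver x hx H hle) := by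
  haveI : CompactSpace ↥H := isCompact_iff_compactSpace.mp hH.isCompact
  exact MonoidHom.isOpenMap_of_sigmaCompact _ (D.augOfOver_surjective x hx H hle hge) (D.continuous_augOfOver x hx H hle)

/-- **The [IUTchI] Ex. 3.2 group datum on ANY closed `H ≤ Π_{C_F}` lying over, and surjecting onto, `G_v̲`** — augmentation GENUINE and
canonical (`augOfOver`), covering DEGENERATE `Π_Ÿ := Π_v̲` («no double cover»: `map_Y` from surjectivity; NOT print's tempered
`Π^tp_{Ÿ_v̲} ⊊ Π^tp_{X̳_v̲}`). ([IUTchI] Ex 3.2 (i)(ii)(v) pp.70-72) [claim: Mochizuki2012, status: disputed] -/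
def badLocalGroupDatumOfOver (hge : D.decompAt x ≤ H.map D.augGF) (hH : IsClosed (H : Set D.PiC)) :
    BadLocalGroupDatum (D.GalAt x hx) ↥H where
  aug := D.augOfOver x hx H hle
  continuous_aug := D.continuous_augOfOver x hx H hle
  isOpenMap_aug := D.isOpenMap_augOfOver x hx H hle hge hH
  Y := ⊤
  map_Y := by
    rw [OpenSubgroup.toSubgroup_top]
    exact Subgroup.map_top_of_surjective _ (D.augOfOver_surjective x hx H hle hge)

/-- Its augmentation is `augOfOver`. ([IUTchI] Def 3.1 (e) p.62) [claim: Mochizuki2012, status: disputed] -/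
theorem badLocalGroupDatumOfOver_aug (hge : D.decompAt x ≤ H.map D.augGF) (hH : IsClosed (H : Set D.PiC)) :
    (D.badLocalGroupDatumOfOver x hx H hle hge hH).aug = D.augOfOver x hx H hle := rfl

/-- Its `Π_Ÿ` is all of `Π_v̲` (the degenerate covering). ([IUTchI] Ex 3.2 (ii) p.70) [claim: Mochizuki2012, status: disputed] -/
theorem badLocalGroupDatumOfOver_Y (hge : D.decompAt x ≤ H.map D.augGF) (hH : IsClosed (H : Set D.PiC)) :
    (D.badLocalGroupDatumOfOver x hx H hle hge hH).Y = ⊤ := rfl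

end Over

/-! ### (m2) at EVERY closed bad pair -/

section BadPair

variable (B : ∀ v, v ∈ D.indexCopyBad → D.BadPairAt v) (x : D.IndexCopy) (hx : x ∈ D.indexCopyBad)

/-- A bad pair's `Π_{X̲̳_v̲}` lies over `G_v̲` (the pair's `le_loc`). ([IUTchI] Def 3.1 (e) p.63) [claim: Mochizuki2012, status: disputed] -/
theorem badPairAt_H_le_comap_decompAt : (B x hx).H ≤ (D.decompAt x).comap D.augGF :=
  le_trans (B x hx).le_loc inf_le_right

/-- A bad pair's `Π_{X̲̳_v̲}` SURJECTS onto `G_v̲`: `G_v̲ ≤ augGF(Π_{X̲̳_v̲}) = G_K ∩ G_v̲` (the pair's `map_augGF`, and `G_v̲ ≤ G_K`, abc-iut-w4-d077 `decompAt_le` ★ p475487).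
([IUTchI] Def 3.1 (e) p.63) [claim: Mochizuki2012, status: disputed] -/
theorem decompAt_le_map_augGF_badPairAt_H : D.decompAt x ≤ (B x hx).H.map D.augGF := by
  rw [(B x hx).map_augGF]
  exact le_inf (D.decompAt_le x) le_rfl

/-- **(m2) AT EVERY CLOSED BAD PAIR — «[aug genuine & canonical, `Ÿ` degenerate]»**: the [IUTchI] Ex. 3.2 group datum on the pair's own
`Π_v̲ := (B x hx).H`, with the genuine augmentation `Π_v̲ ↠ Gal(K̄_v̲/K_v̲)` (continuous, surjective, open) and `Π_Ÿ := Π_v̲`, for ANY bad-pair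
family `B` whose local group at `x` is closed in `Π_{C_F}`. ([IUTchI] Ex 3.2 (i)(ii)(v) pp.70-72) [claim: Mochizuki2012, status: disputed] -/
def m2OfClosed (hH : IsClosed ((B x hx).H : Set D.PiC)) :
    BadLocalGroupDatum (D.GalAt x (D.not_mem_arc_of_mem_bad hx)) ↥(B x hx).H :=
  D.badLocalGroupDatumOfOver x (D.not_mem_arc_of_mem_bad hx) (B x hx).H (D.badPairAt_H_le_comap_decompAt B x hx)
    (D.decompAt_le_map_augGF_badPairAt_H B x hx) hH

/-- Its `Π_Ÿ` is all of `Π_v̲`. ([IUTchI] Ex 3.2 (ii) p.70) [claim: Mochizuki2012, status: disputed] -/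
theorem m2OfClosed_Y (hH : IsClosed ((B x hx).H : Set D.PiC)) : (D.m2OfClosed B x hx hH).Y = ⊤ := rfl

/-- Its augmentation is the canonical `augOfOver`. ([IUTchI] Def 3.1 (e) p.62) [claim: Mochizuki2012, status: disputed] -/
theorem m2OfClosed_aug (hH : IsClosed ((B x hx).H : Set D.PiC)) :
    (D.m2OfClosed B x hx hH).aug =
      D.augOfOver x (D.not_mem_arc_of_mem_bad hx) (B x hx).H (D.badPairAt_H_le_comap_decompAt B x hx) := rfl

/-- Its augmentation is `rhoAt`-compatible: `rhoAt (aug h) = augGF h` on `Π_v̲`. ([IUTchI] Def 3.1 (e) p.62) [claim: Mochizuki2012, status: disputed] -/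
theorem rhoAt_m2OfClosed_aug (hH : IsClosed ((B x hx).H : Set D.PiC)) (h : ↥(B x hx).H) :
    D.rhoAt x (D.not_mem_arc_of_mem_bad hx) ((D.m2OfClosed B x hx hH).aug h) = D.augGF h :=
  D.rhoAt_augOfOver x _ _ (D.badPairAt_H_le_comap_decompAt B x hx) h

/-- Its augmentation is surjective. ([IUTchI] Ex 3.2 (i) p.70) [claim: Mochizuki2012, status: disputed] -/
theorem m2OfClosed_aug_surjective (hH : IsClosed ((B x hx).H : Set D.PiC)) : Function.Surjective (D.m2OfClosed B x hx hH).aug :=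
  D.augOfOver_surjective x _ _ (D.badPairAt_H_le_comap_decompAt B x hx) (D.decompAt_le_map_augGF_badPairAt_H B x hx)

/-- **The (m2) statement recorded as WANTED (abc-iut-w4-d077 gen 8, 2026-08-27T05:21:30Z; GAP row G-L5-EX32M2-1, second conjunct), now a
THEOREM**: for every bad-pair family and every bad index with closed local group, a `BadLocalGroupDatum` with `Π_Ÿ = Π_v̲` EXISTS.
([IUTchI] Ex 3.2 (i)(ii)(v) pp.70-72) [claim: Mochizuki2012, status: disputed] -/
theorem exists_badLocalGroupDatum_of_isClosed (hH : IsClosed ((B x hx).H : Set D.PiC)) :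
    ∃ T : BadLocalGroupDatum (D.GalAt x (D.not_mem_arc_of_mem_bad hx)) ↥(B x hx).H, T.Y = ⊤ :=
  ⟨D.m2OfClosed B x hx hH, rfl⟩

end BadPair

/-! ### The merge record at EVERY closed bad-pair family -/

section Merge

variable (B : ∀ v, v ∈ D.indexCopyBad → D.BadPairAt v) (hH : ∀ x (hx : x ∈ D.indexCopyBad), IsClosed ((B x hx).H : Set D.PiC))

include hH in
/-- **`Nonempty (MergeInputs D B)` at EVERY closed bad-pair family**, from FACT F-0240 `GeomTFG` only: (m2) by `m2OfClosed`, (m1) abc-iut-L5-t3's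
sum model and (m4) `𝒞⊩_mod` via `nonempty_mergeInputs_of_groupData` (★ p500005) BY NAME. ([IUTchI] Def 5.2 (i) p.134) [claim: Mochizuki2012, status: disputed] -/
theorem nonempty_mergeInputs_of_isClosed (hTFG : D.geom.extF.GeomTFG) : Nonempty (D.MergeInputs B) :=
  D.nonempty_mergeInputs_of_groupData B (fun x hx => D.m2OfClosed B x hx (hH x hx)) hTFG

include hH in
/-- At a closed bad-pair family the merge record is inhabited **iff** FACT F-0240 holds (the record carries `geomTFG`; abc-iut-L5-t3's
`nonempty_mergeInputs_iff` BY NAME). ([IUTchI] Def 5.2 (i) p.134) [claim: Mochizuki2012, status: disputed] -/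
theorem nonempty_mergeInputs_iff_geomTFG_of_isClosed : Nonempty (D.MergeInputs B) ↔ D.geom.extF.GeomTFG :=
  ⟨fun h => ((D.nonempty_mergeInputs_iff B).mp h).2, D.nonempty_mergeInputs_of_isClosed B hH⟩

end Merge

/-! ### Consistency at the `X̲→`-profinite stand-in -/

section StandIn

variable (hA : D.geom.pe.ArrowCoveringClaims) (CG : D.geom.pe.CuspGalois) (x : D.IndexCopy) (hx : x ∉ D.indexCopyArc)

/-- The stand-in's local group `Π_{X̲→_K} ∩ augGF⁻¹ G_v̲` lies over `G_v̲`. ([IUTchI] Def 3.1 (f) p.63) [claim: Mochizuki2012, status: disputed] -/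
theorem badPairAtArrow_H_le_comap_decompAt : (D.badPairAtArrow hA x).H ≤ (D.decompAt x).comap D.augGF := by
  rw [badPairAtArrow_H]; exact inf_le_right

/-- abc-iut-L5-t2's stand-in augmentation `augLoc ∘ standInEquiv⁻¹` (★ p499559) is `rhoAt`-compatible (`Π_{X̲→_K} ×_{G_K} Gal(K̄_v̲/K_v̲)` is the
fibre product over `G_F`: `augGF ∘ fstLoc = rhoAt ∘ augLoc`). ([IUTchI] Def 3.1 (e) p.62) [claim: Mochizuki2012, status: disputed] -/
theorem rhoAt_m2StandIn_aug (hTFG : D.geom.extF.GeomTFG) [Fact (D.primeAt x hx).Prime] (h : ↥(D.badPairAtArrow hA x).H) :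
    D.rhoAt x hx ((D.m2StandIn hA CG hTFG x hx).aug h) = D.augGF h := by
  have h1 : (D.m2StandIn hA CG hTFG x hx).aug h =
      D.augLoc D.PiXarrow (D.rhoAt x hx) ((D.standInEquiv hA CG hTFG x hx).symm h) := rfl
  have h2 : D.fstLoc D.PiXarrow (D.rhoAt x hx) ((D.standInEquiv hA CG hTFG x hx).symm h) = (h : D.PiC) := by
    rw [← D.coe_standInHom hA x hx, ← D.standInEquiv_apply hA CG hTFG x hx, ContinuousMulEquiv.apply_symm_apply]
  rw [h1, ← D.augGF_fstLoc, h2]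

/-- **The stand-in augmentation IS the canonical one**: `(m2StandIn …).aug = augOfOver …` (both are `rhoAt`-compatible; `augOfOver_unique`).
([IUTchI] Def 3.1 (e) p.62) [claim: Mochizuki2012, status: disputed] -/
theorem m2StandIn_aug_eq_augOfOver (hTFG : D.geom.extF.GeomTFG) [Fact (D.primeAt x hx).Prime] :
    (D.m2StandIn hA CG hTFG x hx).aug = D.augOfOver x hx (D.badPairAtArrow hA x).H (D.badPairAtArrow_H_le_comap_decompAt hA x) :=
  D.augOfOver_unique x hx _ _ _ (D.rhoAt_m2StandIn_aug hA CG x hx hTFG)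

end StandIn

section StandInBad

variable (hA : D.geom.pe.ArrowCoveringClaims) (CG : D.geom.pe.CuspGalois) (x : D.IndexCopy) (hx : x ∈ D.indexCopyBad)

/-- **At a bad index of the stand-in family the two constructions COINCIDE**: `m2OfClosed (badPairAtArrow hA) x … = m2StandIn hA … x …`
(same canonical augmentation, same degenerate `Π_Ÿ = Π_v̲`; the closedness input `hH` is abc-iut-L5-t2's `isClosed_badPairAtArrow_H`, ★ p501395,
BY NAME). ([IUTchI] Ex 3.2 (i)(ii)(v) pp.70-72) [claim: Mochizuki2012, status: disputed] -/
theorem m2OfClosed_badPairAtArrow_eq_m2StandIn (hTFG : D.geom.extF.GeomTFG) [Fact (D.primeAt x (D.not_mem_arc_of_mem_bad hx)).Prime]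
    (hH : IsClosed ((D.badPairAtArrow hA x).H : Set D.PiC)) :
    D.m2OfClosed (fun v _ => D.badPairAtArrow hA v) x hx hH = D.m2StandIn hA CG hTFG x (D.not_mem_arc_of_mem_bad hx) :=
  BadLocalGroupDatum.ext_of_aug_of_Y
    (by rw [D.m2StandIn_aug_eq_augOfOver]; rfl)
    (by rw [D.m2StandIn_Y]; rfl)

end StandInBad

end InitialThetaData

end Literature.IUT.HodgeTheaters

end
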